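import Literature.Geometry.Kaehler.ComplexTorusAppellHumbertInjective
import Mathlib.Analysis.Complex.Harmonic.MeanValue
import Mathlib.Analysis.InnerProductSpace.Harmonic.Constructions
import HarnessLib

/-!
# Appell–Humbert, injectivity: `L(H, χ) ≅ L(H′, χ′) ⇒ (H, χ) = (H′, χ′)` (Lange 2023, Thm. 1.3.3)

Layer `Literature/Geometry/Kaehler`, namespace `Literature.Geometry.Kaehler.ComplexTorus`; sequel of
`ComplexTorusAppellHumbertGroup` (the group `𝒫(Λ)`, "`L(H, χ) ⊗ L(−H, χ⁻¹)` is trivial") and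
`ComplexTorusAppellHumbertInjective` (the `χ`-half: `L(H, χ) ≅ L(H, χ′) ⇒ χ = χ′`, by Liouville).
Lane `lit-hodgefound`, row A2-29 (b): UNIQUENESS of the Appell–Humbert datum — the injectivity of
`𝒫(Λ) → Pic(X)`, `(H, χ) ↦ L(H, χ)`, in the tree's cocycle presentation of line bundles.

Source: H. Lange, *Abelian Varieties over the Complex Numbers* (Grundlehren Text Edition, 2023), held
copy `book:lange1992-complex-abelian-varieties` (key of record `Lange2023AbelianVarietiesComplex`),
§1.3.2 **Theorem 1.3.3 (Appell–Humbert)** [chunk p0037 L38 – p0038 L8]: "For any complex torus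
`X = V/Λ` there is a canonical isomorphism of exact sequences" between
`1 → Hom(Λ, ℂ₁) → 𝒫(Λ) → NS(X) → 0` and `1 → Pic⁰(X) → Pic(X) →^{c₁} NS(X) → 0`; in particular the
map `𝒫(Λ) → Pic(X)`, `(H, χ) ↦ L(H, χ)`, of Lemma 1.3.1 (ii) is INJECTIVE: `L(H, χ) ≅ L(H′, χ′)`
forces `H = H′` and `χ = χ′`.  Lange obtains `H = H′` from `c₁(L(H, χ)) = H` (Lemma 1.3.1 (ii), via
Thm. 1.2.4) and `χ = χ′` from Liouville [p0038 L33–L38].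

OUR PROOF of `H = H′` avoids `c₁` (the tree's `c₁` of `L(H, χ)` is the named fact
`chernForm_lineBundleAH_eq_neg`, not yet discharged) and uses only Liouville-type arguments, as
Lange's proof of the `χ`-half does: an isomorphism `L(H, χ) ≅ L(H′, χ′)` — a global non-vanishing
holomorphic section of `L(H, χ) ⊗ L(−H′, χ′⁻¹)` — is (Prop. 1.2.3) a NOWHERE-VANISHING theta function
`ϑ` for the canonical factor `a_{(D,ψ)}`, `D = H − H′`, `ψ = χ χ′⁻¹`.  Then
`u = log |ϑ| − (π/2) D(v, v)` is `Λ`-periodic (this is `|a_{(D,ψ)}(λ, v)| = e^{π Re D(v,λ) + (π/2) D(λ,λ)}`),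
hence bounded; on each complex line `z ↦ z w` the function `log |ϑ(z w)| = u(z w) + (π/2) |z|² D(w, w)` is
harmonic (`ϑ` is entire without zeros), so its circle averages equal its value at `0` (mean value
property), which forces `(π/2) |D(w, w)| R² ≤ 2 sup |u|` for every `R`, i.e. `D(w, w) = 0` for all `w`,
and `D = 0` by polarisation.  With `H = H′`, the `χ`-half (`semicharacter_eq_of_isTrivialOn`) gives
`χ = χ′`.

## Contents (proved theorems only; no definitions, no named facts)

* `re_hermOf_symm`, `re_hermOf_add_self`, `re_hermOf_smul_self` — `Re H` is a symmetric real form,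
  `Re H(v + w, v + w) = Re H(v,v) + 2 Re H(v,w) + Re H(w,w)`, `Re H(zw, zw) = |z|² Re H(w, w)` for `η` of
  type `(1,1)` (Lemma 1.2.10);
* `norm_canonicalFactor` — `|a_{(H,χ)}(λ, v)| = exp(π Re H(v, λ) + (π/2) Re H(λ, λ))` for `|χ| = 1`;
* `twoForm_eq_zero_of_thetaFunction_ne_zero` — **a canonical factor `a_{(H,ψ)}` (`η` of type `(1,1)`,
  `|ψ| = 1`) with a NOWHERE-VANISHING theta function has `H = 0`** (the analytic core above);
* `appellHumbertData_eq_of_isTrivialOn` — **`L(H, χ) ⊗ L(−H′, χ′⁻¹)` trivial `⇒ η = η′ ∧ χ = χ′`**: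
  the map `𝒫(Λ) → Pic(X)` is injective (Thm. 1.3.3), in the presentation
  `Pic(X) = {cocycles}/{trivial}` of `ComplexTorusAppellHumbertGroup`.

## References

* [Lange2023AbelianVarietiesComplex] H. Lange, *Abelian Varieties over the Complex Numbers*,
  Grundlehren Text Editions, Springer (2023): §1.2.1 Prop. 1.2.3, §1.2.2 Lemma 1.2.10, §1.3.1 (1.11)
  and Lemma 1.3.1, §1.3.2 Thm. 1.3.3.
-/

noncomputable section

open scoped Manifold ContDiff Topology Real
open Set Filter Function Complex Bornology Metric InnerProductSpace

namespace Literature.Geometry.Kaehler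

namespace ComplexTorus

section AppellHumbertUniqueness

variable {ι : Type*} {E : Type*} [NormedAddCommGroup E] [NormedSpace ℂ E] (Φ : (ι → ℝ) ≃L[ℝ] E)

/-! ### The real part of `H` (Lemma 1.2.10) -/

/-- `H(v, v)` is real: `H(v, v) = Re H(v, v)` (`Im H(v, v) = η(v, v) = 0`).
[cite: Lange2023AbelianVarietiesComplex, §1.2.2 Lemma 1.2.10] -/
theorem hermOf_self_eq_re (η : E [⋀^Fin 2]→L[ℝ] ℝ) (v : E) :
    hermOf η v v = ((hermOf η v v).re : ℂ) := by
  apply Complex.ext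
  · simp
  · rw [hermOf_im, Complex.ofReal_im]
    exact η.map_eq_zero_of_eq ![v, v] (by simp) zero_ne_one

/-- For `η` of type `(1,1)`, `Re H` is symmetric. [cite: Lange2023AbelianVarietiesComplex, §1.2.2 Lemma 1.2.10] -/
theorem re_hermOf_symm (η : E [⋀^Fin 2]→L[ℝ] ℝ) (h11 : ∀ u v : E, η ![I • u, I • v] = η ![u, v])
    (v w : E) : (hermOf η w v).re = (hermOf η v w).re := by
  rw [hermOf_swap η h11 v w, Complex.conj_re]

/-- For `η` of type `(1,1)`: `Re H(v + w, v + w) = Re H(v, v) + 2 Re H(v, w) + Re H(w, w)`.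
[cite: Lange2023AbelianVarietiesComplex, §1.2.2 Lemma 1.2.10] -/
theorem re_hermOf_add_self (η : E [⋀^Fin 2]→L[ℝ] ℝ) (h11 : ∀ u v : E, η ![I • u, I • v] = η ![u, v])
    (v w : E) : (hermOf η (v + w) (v + w)).re =
      (hermOf η v v).re + 2 * (hermOf η v w).re + (hermOf η w w).re := by
  rw [hermOf_add_left, hermOf_add_right, hermOf_add_right, Complex.add_re, Complex.add_re,
    Complex.add_re, re_hermOf_symm η h11 v w]
  ring

/-- For `η` of type `(1,1)`: `Re H(z w, z w) = |z|² Re H(w, w)` (`H` is `ℂ`-linear in the first and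
conjugate-linear in the second argument). [cite: Lange2023AbelianVarietiesComplex, §1.2.2 Lemma 1.2.10] -/
theorem re_hermOf_smul_self (η : E [⋀^Fin 2]→L[ℝ] ℝ) (h11 : ∀ u v : E, η ![I • u, I • v] = η ![u, v])
    (z : ℂ) (w : E) : (hermOf η (z • w) (z • w)).re = ‖z‖ ^ 2 * (hermOf η w w).re := by
  rw [hermOf_smul_left, hermOf_swap η h11 (z • w) w, hermOf_smul_left, map_mul, ← mul_assoc,
    Complex.mul_conj, Complex.normSq_eq_norm_sq, Complex.re_ofReal_mul, Complex.conj_re]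

/-- `H(0, 0) = 0`. [cite: Lange2023AbelianVarietiesComplex, §1.2.2 Lemma 1.2.10] -/
theorem hermOf_zero_zero (η : E [⋀^Fin 2]→L[ℝ] ℝ) : hermOf η (0 : E) 0 = 0 := by
  have h := hermOf_real_smul_left η 0 (0 : E) 0
  rwa [zero_smul, Complex.ofReal_zero, zero_mul] at h

/-! ### The absolute value of the canonical factor -/

/-- **`|a_{(H,χ)}(λ, v)| = exp(π Re H(v, λ) + (π/2) Re H(λ, λ))`** for `|χ| = 1` ((1.11); this is the
computation behind the metric `e^{−π H(v,v)}` of §1.6.1 (1.24)). [cite: Lange2023AbelianVarietiesComplex, §1.3.1 (1.11)] -/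
theorem norm_canonicalFactor (η : E [⋀^Fin 2]→L[ℝ] ℝ) {ψ : (ι → ℤ) → ℂ} (hψ : ∀ n, ‖ψ n‖ = 1)
    (n : ι → ℤ) (v : E) :
    ‖canonicalFactor Φ η ψ n v‖ = Real.exp (π * (hermOf η v (latticeVec Φ n)).re +
      π / 2 * (hermOf η (latticeVec Φ n) (latticeVec Φ n)).re) := by
  rw [canonicalFactor_apply, norm_mul, hψ n, one_mul, Complex.norm_exp,
    show (π : ℂ) / 2 = ((π / 2 : ℝ) : ℂ) by push_cast; ring, Complex.add_re, Complex.re_ofReal_mul,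
    Complex.re_ofReal_mul]

/-- The canonical factor `a_{(H,ψ)}` does not vanish (for `|ψ| = 1`). [cite: Lange2023AbelianVarietiesComplex, §1.3.1 (1.11)] -/
theorem canonicalFactor_ne_zero_of_norm_eq_one (η : E [⋀^Fin 2]→L[ℝ] ℝ) {ψ : (ι → ℤ) → ℂ}
    (hψ : ∀ n, ‖ψ n‖ = 1) (n : ι → ℤ) (v : E) : canonicalFactor Φ η ψ n v ≠ 0 := by
  rw [canonicalFactor_apply]
  refine mul_ne_zero (fun h ↦ ?_) (Complex.exp_ne_zero _)
  have := hψ n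
  rw [h, norm_zero] at this
  exact zero_ne_one this

/-! ### The analytic core: a nowhere-vanishing theta function forces `H = 0` -/

/-- **A canonical factor with a nowhere-vanishing theta function has `H = 0`.**  Let `η` be a real
`2`-form of type `(1,1)` with hermitian form `H`, `ψ : Λ → ℂ₁`, and `ϑ` an entire function without
zeros with `ϑ(v + λ) = a_{(H,ψ)}(λ, v) ϑ(v)`.  Then `η = 0`.  (Our proof — see the module docstring:
`u = log |ϑ| − (π/2) H(v, v)` is `Λ`-periodic hence bounded; on the complex line `z ↦ z w`,
`log |ϑ(z w)| = u(z w) + (π/2) |z|² H(w, w)` is harmonic, so the mean value property over circles of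
radius `R` bounds `(π/2) |H(w, w)| R²` by `2 sup |u|`, whence `H(w, w) = 0`; polarise.)  This is the
`c₁`-injectivity content of the Appell–Humbert theorem (`L(H, χ)` trivial `⇒ H = 0`).
[cite: Lange2023AbelianVarietiesComplex, §1.3.2 Thm. 1.3.3] -/
theorem twoForm_eq_zero_of_thetaFunction_ne_zero {η : E [⋀^Fin 2]→L[ℝ] ℝ}
    (h11 : ∀ u v : E, η ![I • u, I • v] = η ![u, v]) {ψ : (ι → ℤ) → ℂ} (hψ : ∀ n, ‖ψ n‖ = 1)
    {ϑ : E → ℂ} (hϑ : ϑ ∈ thetaFunctions Φ (canonicalFactor Φ η ψ)) (h0 : ∀ v, ϑ v ≠ 0) :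
    η = 0 := by
  have hd : Differentiable ℂ ϑ := hϑ.1
  -- the quadratic form `Q(v) = Re H(v, v) = η(iv, v)` and the function `u`
  set Q : E → ℝ := fun v ↦ (hermOf η v v).re with hQ
  set u : E → ℝ := fun v ↦ Real.log ‖ϑ v‖ - π / 2 * Q v with hu
  have hQ0 : Q 0 = 0 := by simp only [hQ, hermOf_zero_zero, Complex.zero_re]
  -- `u` is `Λ`-periodic …
  have hper : ∀ (n : ι → ℤ) (v : E), u (v + latticeVec Φ n) = u v := by
    intro n v
    simp only [hu, hQ]
    rw [hϑ.2 n v, norm_mul, Real.log_mul (norm_ne_zero_iff.2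
        (canonicalFactor_ne_zero_of_norm_eq_one Φ η hψ n v)) (norm_ne_zero_iff.2 (h0 v)),
      norm_canonicalFactor Φ η hψ n v, Real.log_exp, re_hermOf_add_self η h11 v (latticeVec Φ n)]
    ring
  -- … continuous, hence bounded
  have hcont : Continuous u := by
    have h1 : Continuous fun v : E ↦ Real.log ‖ϑ v‖ :=
      (hd.continuous.norm).log fun v ↦ norm_ne_zero_iff.2 (h0 v)
    have h2 : Continuous fun v : E ↦ (![I • v, v] : Fin 2 → E) := by
      refine continuous_pi fun i ↦ ?_
      fin_cases i
      · exact (continuous_const_smul I : Continuous fun v : E ↦ I • v)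
      · exact continuous_id
    have h3 : Continuous Q := by
      simp only [hQ, hermOf_re]
      exact η.coe_continuous.comp h2
    exact h1.sub (continuous_const.mul h3)
  obtain ⟨C, hC⟩ : ∃ C, ∀ v, |u v| ≤ C := by
    obtain ⟨C, hC⟩ := isBounded_iff_forall_norm_le.1
      (isBounded_range_of_latticePeriodic (Φ := Φ) hcont hper)
    exact ⟨C, fun v ↦ by simpa only [Real.norm_eq_abs] using hC (u v) ⟨v, rfl⟩⟩
  have hC0 : 0 ≤ C := (abs_nonneg _).trans (hC 0)
  -- `Q(w) = 0` for every `w`, by the mean value property on the line `z ↦ z • w`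
  have hQw : ∀ w : E, Q w = 0 := by
    intro w
    -- the restriction of `ϑ` to the line
    have hgd : Differentiable ℂ fun z : ℂ ↦ ϑ (z • w) := hd.comp (differentiable_id.smul_const w)
    have hharm : ∀ z : ℂ, HarmonicAt (fun z : ℂ ↦ Real.log ‖ϑ (z • w)‖) z := fun z ↦
      (hgd.analyticAt z).harmonicAt_log_norm (h0 _)
    -- `log |ϑ(z w)| = u(z w) + (π/2) |z|² Q(w)`
    have hlog : ∀ z : ℂ, Real.log ‖ϑ (z • w)‖ = u (z • w) + π / 2 * (‖z‖ ^ 2 * Q w) := by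
      intro z
      simp only [hu, hQ]
      rw [re_hermOf_smul_self η h11 z w]
      ring
    have hline : Continuous fun z : ℂ ↦ u (z • w) := hcont.comp (continuous_id.smul continuous_const)
    have hci : ∀ R : ℝ, CircleIntegrable (fun z : ℂ ↦ u (z • w)) 0 R := fun R ↦
      hline.continuousOn.circleIntegrable'
    have hci' : ∀ R : ℝ, CircleIntegrable (fun z : ℂ ↦ π / 2 * (‖z‖ ^ 2 * Q w)) 0 R := fun R ↦
      (by fun_prop : Continuous fun z : ℂ ↦ π / 2 * (‖z‖ ^ 2 * Q w)).continuousOn.circleIntegrable'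
    -- mean value: the circle average of `log |ϑ(z w)|` is `u(0)`
    have hmv : ∀ R : ℝ, Real.circleAverage (fun z : ℂ ↦ Real.log ‖ϑ (z • w)‖) 0 R = u 0 := by
      intro R
      rw [HarmonicOnNhd.circleAverage_eq fun z _ ↦ hharm z, hlog 0, zero_smul, norm_zero]
      ring
    -- while it is also `circleAverage (u ∘ line) + (π/2) R² Q(w)`
    have havg : ∀ R : ℝ, Real.circleAverage (fun z : ℂ ↦ Real.log ‖ϑ (z • w)‖) 0 R =
        Real.circleAverage (fun z : ℂ ↦ u (z • w)) 0 R + π / 2 * (R ^ 2 * Q w) := by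
      intro R
      have h1 : (fun z : ℂ ↦ Real.log ‖ϑ (z • w)‖) =
          (fun z : ℂ ↦ u (z • w)) + fun z : ℂ ↦ π / 2 * (‖z‖ ^ 2 * Q w) := by
        funext z
        exact hlog z
      have h2 : Real.circleAverage (fun z : ℂ ↦ π / 2 * (‖z‖ ^ 2 * Q w)) 0 R =
          π / 2 * (R ^ 2 * Q w) :=
        Real.circleAverage_const_on_circle fun x hx ↦ by
          rw [mem_sphere_zero_iff_norm] at hx
          rw [hx, sq_abs]
      rw [h1, Real.circleAverage_add (hci R) (hci' R), h2]
    -- the circle averages of `u ∘ line` are bounded by `C`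
    have hbound : ∀ R : ℝ, |Real.circleAverage (fun z : ℂ ↦ u (z • w)) 0 R| ≤ C := fun R ↦
      Real.abs_circleAverage_le_circleAverage_abs.trans
        (Real.circleAverage_mono_on_of_le_circle (hline.abs.continuousOn.circleIntegrable')
          fun x _ ↦ hC (x • w))
    -- hence `(π/2) |Q w| R² ≤ 2C` for all `R`
    have hineq : ∀ R : ℝ, π / 2 * |Q w| * R ^ 2 ≤ 2 * C := by
      intro R
      have h1 := hmv R
      rw [havg R] at h1
      have h2 : π / 2 * (R ^ 2 * Q w) = u 0 - Real.circleAverage (fun z : ℂ ↦ u (z • w)) 0 R := by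
        linarith
      have h3 : |π / 2 * (R ^ 2 * Q w)| ≤ 2 * C := by
        rw [h2]
        exact (abs_sub _ _).trans (by linarith [hC 0, hbound R])
      rw [abs_mul, abs_mul, abs_of_pos (by positivity : (0 : ℝ) < π / 2), abs_of_nonneg (sq_nonneg R)]
        at h3
      linarith
    -- so `Q w = 0`
    by_contra hne
    have hpos : 0 < π / 2 * |Q w| := mul_pos (by positivity) (abs_pos.2 hne)
    set R : ℝ := max 1 ((2 * C + 1) / (π / 2 * |Q w|)) with hR
    have hR1 : 1 ≤ R := le_max_left _ _
    have hR2 : 2 * C + 1 ≤ π / 2 * |Q w| * R := by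
      have := le_max_right 1 ((2 * C + 1) / (π / 2 * |Q w|))
      rw [← hR, div_le_iff₀ hpos] at this
      linarith
    have hR3 : π / 2 * |Q w| * R ≤ π / 2 * |Q w| * R ^ 2 := by
      have : R ≤ R ^ 2 := by nlinarith
      exact mul_le_mul_of_nonneg_left this hpos.le
    linarith [hineq R]
  -- polarisation: `Re H = 0`, hence `η = 0`
  have hB : ∀ v w : E, (hermOf η v w).re = 0 := by
    intro v w
    have h := re_hermOf_add_self η h11 v w
    have e1 : (hermOf η (v + w) (v + w)).re = 0 := hQw (v + w)
    have e2 : (hermOf η v v).re = 0 := hQw v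
    have e3 : (hermOf η w w).re = 0 := hQw w
    linarith
  ext x
  have hx : x = ![x 0, x 1] := by
    funext i
    fin_cases i <;> rfl
  have h := hB (-(I • x 0)) (x 1)
  rw [hermOf_re, smul_neg, smul_smul, Complex.I_mul_I, neg_one_smul, neg_neg] at h
  rw [hx]
  simpa using h

/-! ### Injectivity of `𝒫(Λ) → Pic(X)` (Thm. 1.3.3) -/

variable {Φ} [Fintype ι]

/-- **Appell–Humbert, injectivity (Thm. 1.3.3): `L(H, χ) ⊗ L(−H′, χ′⁻¹)` trivial `⇒ H = H′ ∧ χ = χ′`**,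
i.e. `L(H, χ) ≅ L(H′, χ′) ⇒ (H, χ) = (H′, χ′)` in the presentation `Pic(X) = {cocycles}/{trivial}` of
`ComplexTorusAppellHumbertGroup`: the map `𝒫(Λ) → Pic(X)`, `(H, χ) ↦ L(H, χ)`, is injective.
(Lange: `H = c₁(L(H, χ))` by Lemma 1.3.1 (ii) and `χ` by Liouville; here `H = H′` is
`twoForm_eq_zero_of_thetaFunction_ne_zero` applied to the nowhere-vanishing theta function of the
trivialising section (Prop. 1.2.3), and `χ = χ′` is `semicharacter_eq_of_isTrivialOn`.)
[cite: Lange2023AbelianVarietiesComplex, §1.3.2 Thm. 1.3.3] -/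
theorem appellHumbertData_eq_of_isTrivialOn {η η' : E [⋀^Fin 2]→L[ℝ] ℝ} {χ χ' : (ι → ℤ) → ℂ}
    (hη : IsNSForm Φ η) (hχ : IsSemicharacter Φ η χ) (hη' : IsNSForm Φ η') (hχ' : IsSemicharacter Φ η' χ')
    (h : ((lineBundleAH hη hχ).tensor (lineBundleAH hη'.neg hχ'.inv)).IsTrivialOn univ) :
    η = η' ∧ χ = χ' := by
  -- first `η = η'`: a nowhere-vanishing theta function for `a_{(η + (−η′), χ χ′⁻¹)}`
  have hηη' : η = η' := by
    obtain ⟨s, hs, hs0, hsg⟩ := h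
    have he : IsFactor Φ (canonicalFactor Φ (η + -η') (χ * χ'⁻¹)) :=
      isFactor_canonicalFactor Φ (hη.add hη'.neg) (hχ.mul hχ'.inv)
    set s' : (ι → ℝ) → ComplexTorus Φ → ℂ := fun a ↦ (chart Φ a).source.indicator (s (a, a))
      with hs'def
    have hs'mem : ∀ a, ∀ x ∈ (chart Φ a).source, s' a x = s (a, a) x := fun a x hx ↦
      indicator_of_mem hx _
    have hs' : s' ∈ (lineBundleAH (hη.add hη'.neg) (hχ.mul hχ'.inv)).sectionSpace := by
      refine HolomorphicLineBundle.mem_sectionSpace_iff.2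
        ⟨fun a ↦ ?_, fun a b x hx ↦ ?_, fun a x hx ↦ ?_⟩
      · exact ((hs (a, a)).mono fun x hx ↦ ⟨⟨hx, hx⟩, mem_univ x⟩).congr fun x hx ↦ hs'mem a x hx
      · obtain ⟨ha, hb⟩ := hx
        rw [hs'mem b x hb, hs'mem a x ha, hsg (a, a) (b, b) x ⟨⟨⟨ha, ha⟩, hb, hb⟩, mem_univ x⟩,
          ← coordChange_lineBundleAH_add_mul_eq_tensor hη hχ hη'.neg hχ'.inv]
      · exact indicator_of_notMem hx _
    have hϑ0 : ∀ v : E, ((thetaEquiv he).symm ⟨s', hs'⟩ : E → ℂ) v ≠ 0 := by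
      intro v
      have ha : cover Φ v ∈ (chart Φ (corner Φ (cover Φ v))).source := by
        rw [← chartAt_eq]
        exact mem_chart_source E _
      rw [thetaEquiv_symm_apply_eq he ⟨s', hs'⟩ ha]
      refine mul_ne_zero (he.ne_zero _ _) ?_
      show s' _ _ ≠ 0
      rw [hs'mem _ _ ha]
      exact hs0 _ _ ⟨⟨ha, ha⟩, mem_univ _⟩
    have h11 : ∀ u v : E, (η + -η') ![I • u, I • v] = (η + -η') ![u, v] := (hη.add hη'.neg).type_one_one
    have hψ : ∀ n, ‖(χ * χ'⁻¹) n‖ = 1 := fun n ↦ by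
      rw [Pi.mul_apply, Pi.inv_apply, norm_mul, norm_inv, hχ.norm_eq_one, hχ'.norm_eq_one, inv_one,
        mul_one]
    have hzero := twoForm_eq_zero_of_thetaFunction_ne_zero Φ h11 hψ ((thetaEquiv he).symm ⟨s', hs'⟩).2 hϑ0
    exact (add_neg_eq_zero.1 hzero)
  subst hηη'
  exact ⟨rfl, semicharacter_eq_of_isTrivialOn hη hχ hχ' h⟩

end AppellHumbertUniqueness

end ComplexTorus

end Literature.Geometry.Kaehler

end
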